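import Mathlib
import HarnessLib
import Summits.HubbardSuperconductivity.HubbardSuperconductivity.Theorems.KLProgrammeKLRegimeCountertermJacksonRemainderOneCall
import Summits.HubbardSuperconductivity.HubbardSuperconductivity.Theorems.KLProgrammeKLRegimeCountertermJacksonRemainderCurveGraded

/-!
# (C1) JACKSON REMAINDER AT DEEP SCALES — the ONE-CALL door with GRADED curve jets, in ROW form

Cell `gate-hubbard-kl`, seat hubbard-kl-k3c3-p3 (g11), `--supports stmt-HubbardSuperconductivity-20437` (stub (C) of `KLRegimeEngineV17F2`); pen (R79)
«(C1)-DEEP analytic supplier» GO, file 2.  Memo `HOME/hubbard-kl-k3c3-p3/C1-JETBOX-DEEP.md`.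

k3c3-p1's `flowPiece_reading_remainder_jets_meanFree` / `…_oneCall` (parts 5/6, p536588/p537162) bound the value and the four jets of
`R = (klFlowPiece n).eval ∘ k_F^{K′} − ν_n(K_n)` from the ANGULAR data of the reading and three centre numbers, through a SINGLE curve constant
`‖γ^{(i)}(θ)‖ ≤ Dⁱ`.  This file is the twin with GRADED curve jets `‖γ^{(i)}(θ)‖ ≤ D i` (the flow frame's `γ‴, γ⁗` grow like `4ⁿ, 16ⁿ` at deep
reading scales while `γ′, γ″` do not) and with the output REGROUPED BY KERNEL HOMOGENEITY — `m₁`-rows (`≍ 1/(d+1)`), `τ`-rows (`≍ 1/((d+1)δ)³`),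
the no-rate top row — i.e. in the row shapes of `jacksonScale_term_law` / `jacksonScale_frame_term_law` (…JacksonRemainderScaleLaw):

* `flowPiece_reading_remainder_jets_meanFree_bell` (sizes `B`, `Ml` of the MEAN-FREE extension supplied by the caller);
* **`flowPiece_reading_remainder_jets_oneCall_bell`** (one call: `Ml = (G₀ | a₁/ρ | (a₂+a₁)/ρ² | (a₃+3a₂+2a₁)/ρ³ | (a₄+6a₃+11a₂+6a₁)/ρ⁴)`,
  `B i = (i!)²(2·i!·X·200ⁱ)·G·(4 + max 1 ((i−1)!/(8/5)))ⁱ`, exactly as in part 6).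

Everything else (objects, hypotheses `hon`/`htube`/`hcell`/`hrad`, the mean-free reduction) is part 5/6 verbatim; the only change is the last step
(`jacksonRemainder_curve_jets_bell_rows` for `jacksonRemainder_curve_jets`).  Bookkeeping only; no definitions; nothing about the model.
-/

noncomputable section

namespace Summit.HubbardSuperconductivity.HubbardSuperconductivity.Theorems.KLRegimeSplit

set_option linter.dupNamespace false -- summit = problem name (single-conjunct summit), D-0017

open Real MeasureTheory Filter
open Literature.Analysis.Fourier.TrigApprox Literature.MathematicalPhysics.QuantumLattice
open Summit.HubbardSuperconductivity.HubbardSuperconductivity.Theorems.PerturbedFermiCurve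

section Graded

variable {L M : ℕ} [NeZero L] [NeZero M]

/-- **THE (C1) DOOR AT THE FLOW PIECE, MEAN-FREE SIZES, GRADED CURVE JETS, ROW FORM.**  As `flowPiece_reading_remainder_jets_meanFree` with
`‖γ^{(i)}(θ)‖ ≤ D i` (`1 ≤ i ≤ 4`) in place of `Dⁱ`; `τ = π³/((d+1)δ)³`, `d = klFlowDeg n`:
`|R| ≤ m₁·Ml 1 + τ·(B 0 + Ml 0)`, `|R′| ≤ m₁·(Ml 2·D₁) + τ·((B 1+Ml 1)D₁)`, `|R″| ≤ m₁·(Ml 3·D₁² + Ml 2·D₂) + τ·((B 2+Ml 2)D₁² + (B 1+Ml 1)D₂)`,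
`|R‴| ≤ m₁·(Ml 4·D₁³ + 3Ml 3·D₁D₂ + Ml 2·D₃) + τ·(…)`, `|R⁗| ≤ 2Ml 4·D₁⁴ + m₁·(6Ml 4·D₁²D₂ + 3Ml 3·D₂² + 4Ml 3·D₁D₃ + Ml 2·D₄) + τ·(…)`. -/
theorem flowPiece_reading_remainder_jets_meanFree_bell (β U : ℝ) {μ : ℝ} (hμ : μ ∈ klWindowC) (n : ℕ) (K' : TrigPolyC4v)
    (hf : ContDiff ℝ 4 fun θ : ℝ => klLocalPart L M β U μ (klFlowFrameU L M β U μ n) n θ)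
    (hon : ∀ θ, klFrameExtFn μ (fun θ => klLocalPart L M β U μ (klFlowFrameU L M β U μ n) n θ) (klFermiPoint μ K' θ) =
      klLocalPart L M β U μ (klFlowFrameU L M β U μ n) n θ)
    {B : ℕ → ℝ} (hB : ∀ i ≤ 4, ∀ y, ‖iteratedFDeriv ℝ i
      (onM (klFrameExtFn μ fun θ => klLocalPart L M β U μ (klFlowFrameU L M β U μ n) n θ -
        klAngularMean fun θ => klLocalPart L M β U μ (klFlowFrameU L M β U μ n) n θ)) y‖ ≤ B i)
    (hγ : ContDiff ℝ 4 fun θ => (WithLp.toLp 2 (klFermiPoint μ K' θ) : EuclideanSpace ℝ (Fin 2)))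
    {θ r δ : ℝ} {D : ℕ → ℝ} {Ml : ℕ → ℝ}
    (hMl : ∀ i ≤ 4, ∀ y : EuclideanSpace ℝ (Fin 2), ‖y - WithLp.toLp 2 (klFermiPoint μ K' θ)‖ ≤ r →
      ‖iteratedFDeriv ℝ i (onM (klFrameExtFn μ fun θ => klLocalPart L M β U μ (klFlowFrameU L M β U μ n) n θ -
        klAngularMean fun θ => klLocalPart L M β U μ (klFlowFrameU L M β U μ n) n θ)) y‖ ≤ Ml i)
    (hδ : 0 < δ) (hδπ : δ ≤ π) (hδr : 2 * δ ≤ r) {m₁ : ℝ} (hm₁ : ∫ w, jweight (klFlowDeg n) w * (|w.1| + |w.2|) ∂jmeas ≤ m₁)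
    (hD : ∀ i, 1 ≤ i → i ≤ 4 →
      ‖iteratedDeriv i (fun θ => (WithLp.toLp 2 (klFermiPoint μ K' θ) : EuclideanSpace ℝ (Fin 2))) θ‖ ≤ D i) :
    |(klFlowPiece L M β U μ n).eval (klFermiPoint μ K' θ) - klLocalPart L M β U μ (klFlowFrameU L M β U μ n) n θ| ≤
      m₁ * Ml 1 + (π ^ 3 / ((klFlowDeg n + 1) * δ) ^ 3) * (B 0 + Ml 0) ∧
    |iteratedDeriv 1 (fun θ => (klFlowPiece L M β U μ n).eval (klFermiPoint μ K' θ) -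
        klLocalPart L M β U μ (klFlowFrameU L M β U μ n) n θ) θ| ≤
      m₁ * (Ml 2 * D 1) + (π ^ 3 / ((klFlowDeg n + 1) * δ) ^ 3) * ((B 1 + Ml 1) * D 1) ∧
    |iteratedDeriv 2 (fun θ => (klFlowPiece L M β U μ n).eval (klFermiPoint μ K' θ) -
        klLocalPart L M β U μ (klFlowFrameU L M β U μ n) n θ) θ| ≤
      m₁ * (Ml 3 * D 1 ^ 2 + Ml 2 * D 2) + (π ^ 3 / ((klFlowDeg n + 1) * δ) ^ 3) * ((B 2 + Ml 2) * D 1 ^ 2 + (B 1 + Ml 1) * D 2) ∧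
    |iteratedDeriv 3 (fun θ => (klFlowPiece L M β U μ n).eval (klFermiPoint μ K' θ) -
        klLocalPart L M β U μ (klFlowFrameU L M β U μ n) n θ) θ| ≤
      m₁ * (Ml 4 * D 1 ^ 3 + 3 * Ml 3 * D 1 * D 2 + Ml 2 * D 3) +
        (π ^ 3 / ((klFlowDeg n + 1) * δ) ^ 3) * ((B 3 + Ml 3) * D 1 ^ 3 + 3 * (B 2 + Ml 2) * D 1 * D 2 + (B 1 + Ml 1) * D 3) ∧
    |iteratedDeriv 4 (fun θ => (klFlowPiece L M β U μ n).eval (klFermiPoint μ K' θ) -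
        klLocalPart L M β U μ (klFlowFrameU L M β U μ n) n θ) θ| ≤
      2 * Ml 4 * D 1 ^ 4 +
        m₁ * (6 * Ml 4 * D 1 ^ 2 * D 2 + 3 * Ml 3 * D 2 ^ 2 + 4 * Ml 3 * D 1 * D 3 + Ml 2 * D 4) +
        (π ^ 3 / ((klFlowDeg n + 1) * δ) ^ 3) *
          (B 4 * D 1 ^ 4 + 6 * (B 3 + Ml 3) * D 1 ^ 2 * D 2 + 3 * (B 2 + Ml 2) * D 2 ^ 2 + 4 * (B 2 + Ml 2) * D 1 * D 3 +
            (B 1 + Ml 1) * D 4) := by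
  set f : ℝ → ℝ := fun θ => klLocalPart L M β U μ (klFlowFrameU L M β U μ n) n θ with hfdef
  set F₀ : (Fin 2 → ℝ) → ℝ := klFrameExtFn μ fun t => f t - klAngularMean f with hF₀def
  set γ : ℝ → EuclideanSpace ℝ (Fin 2) := fun θ => WithLp.toLp 2 (klFermiPoint μ K' θ) with hγdef
  have hper : Function.Periodic f (2 * Real.pi) := klLocalPart_periodic β U μ _ n
  have hg : ContDiff ℝ 4 (fun t : ℝ => f t - klAngularMean f) := hf.sub contDiff_const
  have hgper : Function.Periodic (fun t : ℝ => f t - klAngularMean f) (2 * Real.pi) := fun t => by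
    show f (t + 2 * Real.pi) - klAngularMean f = f t - klAngularMean f
    rw [hper t]
  have hG : ContDiff ℝ 4 (fun q : EuclideanSpace ℝ (Fin 2) => F₀ (WithLp.ofLp q)) := contDiff_onM_klFrameExtFn (N := 4) hg hgper hμ
  have hFc : Continuous F₀ := continuous_of_continuous_comp_ofLp hG.continuous
  have hB' : ∀ i ≤ 4, ∀ y, ‖iteratedFDeriv ℝ i (fun q : EuclideanSpace ℝ (Fin 2) => F₀ (WithLp.ofLp q)) y‖ ≤ B i := hB
  have hMl' : ∀ i ≤ 4, ∀ y : EuclideanSpace ℝ (Fin 2), ‖y - γ θ‖ ≤ r →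
      ‖iteratedFDeriv ℝ i (fun q : EuclideanSpace ℝ (Fin 2) => F₀ (WithLp.ofLp q)) y‖ ≤ Ml i := hMl
  have hobj := flowPiece_eval_sub_eq_neg_jhigh1_meanFree (L := L) (M := M) β U hμ n K' hf hon
  have hR : (fun θ => (klFlowPiece L M β U μ n).eval (klFermiPoint μ K' θ) - f θ) =
      -((fun q : EuclideanSpace ℝ (Fin 2) => jhigh1 (klFlowDeg n) F₀ (WithLp.ofLp q)) ∘ γ) := by
    rw [hobj]; rfl
  obtain ⟨j1, j2, j3, j4⟩ := jacksonRemainder_curve_jets_bell_rows (klFlowDeg n) hFc hG hB' hγ hMl' hδ hδπ hδr hm₁ hD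
  have hval := jacksonRemainder_curve_value_rows (klFlowDeg n) hFc hG hB' hMl' hδ hδπ hδr hm₁ (γ := γ) (θ := θ)
  refine ⟨?_, ?_, ?_, ?_, ?_⟩
  · have e : (klFlowPiece L M β U μ n).eval (klFermiPoint μ K' θ) - f θ =
        -(((fun q : EuclideanSpace ℝ (Fin 2) => jhigh1 (klFlowDeg n) F₀ (WithLp.ofLp q)) ∘ γ) θ) := congrFun hR θ
    rw [e, abs_neg]
    exact_mod_cast hval
  · rw [hR, iteratedDeriv_neg, abs_neg]; exact_mod_cast j1
  · rw [hR, iteratedDeriv_neg, abs_neg]; exact_mod_cast j2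
  · rw [hR, iteratedDeriv_neg, abs_neg]; exact_mod_cast j3
  · rw [hR, iteratedDeriv_neg, abs_neg]; exact_mod_cast j4

/-- **THE (C1) DOOR, ONE CALL, GRADED CURVE JETS, ROW FORM.**  As `flowPiece_reading_remainder_jets_oneCall` (part 6) with `‖γ^{(i)}(θ)‖ ≤ D i`
(`1 ≤ i ≤ 4`) in place of `Dⁱ`: `f := ν_n(K_n)` (`C⁴`), `K′` any frame whose Fermi points the extension reads (`hon`), angular data `‖Dᵏf‖ ≤ a k`
(`1 ≤ k ≤ 4`), `|f − mean f| ≤ G₀`, `‖Dⁱ(f − mean f)‖ ≤ G` (`i ≤ 4`), `χ₂` numeral `X`, centre numbers `|ε(x) − μ| + 4r < klFlatR`, `|xᵢ| + r < π`,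
`ρ + r ≤ ‖x‖` at `x = k_F^{K′}(θ)`, margin `0 < δ ≤ π`, `2δ ≤ r`, first moment `m₁`; `Ml = (G₀ | a₁/ρ | (a₂+a₁)/ρ² | (a₃+3a₂+2a₁)/ρ³ |
(a₄+6a₃+11a₂+6a₁)/ρ⁴)`, `B i = (i!)²(2·i!·X·200ⁱ)·G·(4 + max 1 ((i−1)!/(8/5)))ⁱ`, `τ = π³/((d+1)δ)³`, `d = klFlowDeg n`; output = the five rows of
`flowPiece_reading_remainder_jets_meanFree_bell`.  At deep reading scales: `m₁ = π√3/(d+1)` (…JacksonSharpMoments), `D 1, D 2, ρ, r, δ, X, B` are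
`n`-free window/cutoff constants, `D 3, D 4` carry the flow frame's growth, `a k ≤ curveJetBar c c' U k n` — then every row is a row of
`jacksonScale_term_law` / `jacksonScale_frame_term_law`. -/
theorem flowPiece_reading_remainder_jets_oneCall_bell (β U : ℝ) {μ : ℝ} (hμ : μ ∈ klWindowC) (n : ℕ) (K' : TrigPolyC4v)
    (hf : ContDiff ℝ 4 fun θ : ℝ => klLocalPart L M β U μ (klFlowFrameU L M β U μ n) n θ)
    (hon : ∀ θ, klFrameExtFn μ (fun θ => klLocalPart L M β U μ (klFlowFrameU L M β U μ n) n θ) (klFermiPoint μ K' θ) =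
      klLocalPart L M β U μ (klFlowFrameU L M β U μ n) n θ)
    (hγ : ContDiff ℝ 4 fun θ => (WithLp.toLp 2 (klFermiPoint μ K' θ) : EuclideanSpace ℝ (Fin 2)))
    {θ r ρ δ G₀ G X m₁ : ℝ} {a D : ℕ → ℝ}
    (ha : ∀ k, 1 ≤ k → k ≤ 4 → ∀ t : ℝ,
      ‖iteratedFDeriv ℝ k (fun θ : ℝ => klLocalPart L M β U μ (klFlowFrameU L M β U μ n) n θ) t‖ ≤ a k)
    (hG₀ : ∀ t : ℝ, |klLocalPart L M β U μ (klFlowFrameU L M β U μ n) n t -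
      klAngularMean (fun θ : ℝ => klLocalPart L M β U μ (klFlowFrameU L M β U μ n) n θ)| ≤ G₀)
    (hG : ∀ i ≤ 4, ∀ t : ℝ, ‖iteratedFDeriv ℝ i (fun t => klLocalPart L M β U μ (klFlowFrameU L M β U μ n) n t -
      klAngularMean (fun θ : ℝ => klLocalPart L M β U μ (klFlowFrameU L M β U μ n) n θ)) t‖ ≤ G)
    (hX : ∀ l ≤ 4, ∀ x : ℝ, ‖iteratedFDeriv ℝ l salmhoferCutoff x‖ ≤ X)
    (hρ : 0 < ρ)
    (htube : |sqDispersion (WithLp.ofLp (WithLp.toLp 2 (klFermiPoint μ K' θ) : EuclideanSpace ℝ (Fin 2))) - μ| + 4 * r < klFlatR)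
    (hcell : ∀ i, |WithLp.ofLp (WithLp.toLp 2 (klFermiPoint μ K' θ) : EuclideanSpace ℝ (Fin 2)) i| + r < π)
    (hrad : ρ + r ≤ ‖(WithLp.toLp 2 (klFermiPoint μ K' θ) : EuclideanSpace ℝ (Fin 2))‖)
    (hδ : 0 < δ) (hδπ : δ ≤ π) (hδr : 2 * δ ≤ r) (hm₁ : ∫ w, jweight (klFlowDeg n) w * (|w.1| + |w.2|) ∂jmeas ≤ m₁)
    (hD : ∀ i, 1 ≤ i → i ≤ 4 →
      ‖iteratedDeriv i (fun θ => (WithLp.toLp 2 (klFermiPoint μ K' θ) : EuclideanSpace ℝ (Fin 2))) θ‖ ≤ D i) :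
    let Ml : ℕ → ℝ := fun i => match i with
      | 0 => G₀
      | 1 => a 1 / ρ
      | 2 => (a 2 + a 1) / ρ ^ 2
      | 3 => (a 3 + 3 * a 2 + 2 * a 1) / ρ ^ 3
      | _ => (a 4 + 6 * a 3 + 11 * a 2 + 6 * a 1) / ρ ^ 4
    let B : ℕ → ℝ := fun i => (i.factorial : ℝ) ^ 2 * (2 * i.factorial * X * 200 ^ i) * G * (4 + max 1 (((i - 1).factorial : ℝ) / (8 / 5))) ^ i
    let τ : ℝ := π ^ 3 / ((klFlowDeg n + 1) * δ) ^ 3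
    |(klFlowPiece L M β U μ n).eval (klFermiPoint μ K' θ) - klLocalPart L M β U μ (klFlowFrameU L M β U μ n) n θ| ≤
      m₁ * Ml 1 + τ * (B 0 + Ml 0) ∧
    |iteratedDeriv 1 (fun θ => (klFlowPiece L M β U μ n).eval (klFermiPoint μ K' θ) -
        klLocalPart L M β U μ (klFlowFrameU L M β U μ n) n θ) θ| ≤ m₁ * (Ml 2 * D 1) + τ * ((B 1 + Ml 1) * D 1) ∧
    |iteratedDeriv 2 (fun θ => (klFlowPiece L M β U μ n).eval (klFermiPoint μ K' θ) -
        klLocalPart L M β U μ (klFlowFrameU L M β U μ n) n θ) θ| ≤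
      m₁ * (Ml 3 * D 1 ^ 2 + Ml 2 * D 2) + τ * ((B 2 + Ml 2) * D 1 ^ 2 + (B 1 + Ml 1) * D 2) ∧
    |iteratedDeriv 3 (fun θ => (klFlowPiece L M β U μ n).eval (klFermiPoint μ K' θ) -
        klLocalPart L M β U μ (klFlowFrameU L M β U μ n) n θ) θ| ≤
      m₁ * (Ml 4 * D 1 ^ 3 + 3 * Ml 3 * D 1 * D 2 + Ml 2 * D 3) +
        τ * ((B 3 + Ml 3) * D 1 ^ 3 + 3 * (B 2 + Ml 2) * D 1 * D 2 + (B 1 + Ml 1) * D 3) ∧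
    |iteratedDeriv 4 (fun θ => (klFlowPiece L M β U μ n).eval (klFermiPoint μ K' θ) -
        klLocalPart L M β U μ (klFlowFrameU L M β U μ n) n θ) θ| ≤
      2 * Ml 4 * D 1 ^ 4 +
        m₁ * (6 * Ml 4 * D 1 ^ 2 * D 2 + 3 * Ml 3 * D 2 ^ 2 + 4 * Ml 3 * D 1 * D 3 + Ml 2 * D 4) +
        τ * (B 4 * D 1 ^ 4 + 6 * (B 3 + Ml 3) * D 1 ^ 2 * D 2 + 3 * (B 2 + Ml 2) * D 2 ^ 2 + 4 * (B 2 + Ml 2) * D 1 * D 3 +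
          (B 1 + Ml 1) * D 4) := by
  intro Ml B τ
  set f : ℝ → ℝ := fun θ => klLocalPart L M β U μ (klFlowFrameU L M β U μ n) n θ with hfdef
  have hper : Function.Periodic f (2 * Real.pi) := klLocalPart_periodic β U μ _ n
  have hfi : IntervalIntegrable f volume 0 (2 * π) := hf.continuous.intervalIntegrable _ _
  have hg : ContDiff ℝ 4 (fun t : ℝ => f t - klAngularMean f) := hf.sub contDiff_const
  have hgper : Function.Periodic (fun t : ℝ => f t - klAngularMean f) (2 * Real.pi) := fun t => by
    show f (t + 2 * Real.pi) - klAngularMean f = f t - klAngularMean f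
    rw [hper t]
  -- global sizes of the mean-free extension
  have hB : ∀ i ≤ 4, ∀ y, ‖iteratedFDeriv ℝ i (onM (klFrameExtFn μ fun t => f t - klAngularMean f)) y‖ ≤ B i :=
    fun i hi y => norm_iteratedFDeriv_onM_klFrameExtFn_meanFree_le hf hper hμ hG hX hi y
  -- local sizes on the ball, at the mean-free profile
  have ha' : ∀ k, 1 ≤ k → k ≤ 4 → ∀ t : ℝ, ‖iteratedFDeriv ℝ k (fun t => f t - klAngularMean f) t‖ ≤ a k := by
    intro k hk1 hk4 t
    rw [norm_iteratedFDeriv_sub_const_of_one_le f _ hk1]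
    exact ha k hk1 hk4 t
  have hG₀' : ∀ t : ℝ, |(f t - klAngularMean f) - klAngularMean (fun t => f t - klAngularMean f)| ≤ G₀ := by
    intro t
    rw [klAngularMean_sub_mean f hfi, sub_zero]
    exact hG₀ t
  have hMl : ∀ i ≤ 4, ∀ y : EuclideanSpace ℝ (Fin 2), ‖y - WithLp.toLp 2 (klFermiPoint μ K' θ)‖ ≤ r →
      ‖iteratedFDeriv ℝ i (onM (klFrameExtFn μ fun t => f t - klAngularMean f)) y‖ ≤ Ml i := by
    intro i hi y hy
    have h := localSizes_onM_klFrameExtFn_of_ball hg hgper hρ htube hcell hrad ha' hG₀' hi y hy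
    rw [klAngularMean_sub_mean f hfi, abs_zero, zero_add] at h
    interval_cases i <;> exact h
  exact flowPiece_reading_remainder_jets_meanFree_bell (L := L) (M := M) β U hμ n K' hf hon hB hγ hMl hδ hδπ hδr hm₁ hD

end Graded

end Summit.HubbardSuperconductivity.HubbardSuperconductivity.Theorems.KLRegimeSplit

end
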